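import Mathlib
import Summits.ValiantsHypothesis.ValiantsHypothesis.Theorems.FifoMatchingNNDivisionHardFewFlatsExp
import HarnessLib

/-!
# ★★★ `NNDivisionHard` ON COFACTORS THAT ARE `2^{κ√n}`-SPARSE IN ALL BUT `κ√n` VARIABLES (a member of the PARALLEL-FLATS class;
# crux `Theses.FifoMatching.NNDivisionHard`, stmt-ValiantsHypothesis-21181)

WHAT IS NEW.  A concrete, coordinate-described member of the parallel-flats class of ✓ `…FewFlatsExp.nnDivisionHard_fewFlatsExp`:
cofactors `hh` for which some set `Z` of at most `κ√n` variables carries all the density — after forgetting the exponents of the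
variables in `Z` (equivalently, over `ℝ≥0`, after the substitution `x_z := 1`, `z ∈ Z`, which merges monomials without
cancellation) at most `2^{κ√n}` monomials remain.  In symbols: `hh = Σ_{i<N} y^{α_i} · q_i(z)`, `N ≤ 2^{κ√n}` distinct monomials
`y^{α_i}` in the variables off `Z`, ARBITRARY polynomials `q_i` in the `|Z| ≤ κ√n` variables of `Z` (any degrees, any number of
monomials).  The support of such an `hh` lies on `N` parallel translates of the coordinate space `ℝ^Z`:

* `realOf_sub_mem_span_single` — equal exponents off `Z` ⇒ the difference of the exponent points lies in `span{e_z : z ∈ Z}`;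
* ★★★ `nnDivisionHard_sparseOffFewVars` — `∃ κ > 0 ∀ c`, eventually in `n`: every `hh ≠ 0` over `ℝ≥0` and every `Z` with
  `|Z| ≤ κ√n` and `#{d|_{Zᶜ} : d ∈ supp hh} ≤ 2^{κ√n}` satisfy `2^((log₂ n + c)^c) < L₊(NN_n · hh) + L₊(hh)`.

`Z = ∅` is the few-monomials tier (✓ `…FewGeneratorsExp.nnDivisionHard_fewMonomialsExp`); a polynomial in `κ√n` variables is the
coordinate case of the dimension tier (✓ `…LowDimRate.nnDivisionHard_lowdim`); the class here contains cofactors in NEITHER tier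
(e.g. `Σ_{i<n} y_i · q_i(z)` with pairwise different vertex-rich `Newt q_i`: dimension `≥ n − 1`, vertices `Σ_i #vert Newt q_i`).

MECHANISM: ✓ `…FewFlatsExp.nnDivisionHard_fewFlatsExp` (PARALLEL-FLATS RUNG + transport) with labels `d ↦ d|_{Zᶜ}` and direction
space `span{e_z : z ∈ Z}` (`finrank_range_le_card`).  No definitions, no named facts, no sorry.

HONEST FRAMING: a restriction theorem (a decided sub-class of cofactors), NOT the crux: stmt-21181 `NNDivisionHard` (all cofactors)
OPEN; COR-MINKOWSKI / COR-VIRTUAL OPEN; `NNNotVP` OPEN; `VP ≠ VNP` NOT proved; nothing here is a summit statement.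
References: Hrubeš–Yehudayoff 2021 §6 Problem 2 [HrubesYehudayoff2021]; Kaibel–Weltge 2015 Thm 1 [KaibelWeltge2014].
-/

set_option autoImplicit false

-- the mandated summit-side namespace repeats a component by design (single-problem summit)
set_option linter.dupNamespace false

noncomputable section

open Matrix Finset
open scoped Pointwise

namespace Summit.ValiantsHypothesis.ValiantsHypothesis.Theorems.FifoMatching

namespace FewFlats

open MvPolynomial
open scoped NNReal
open Literature.Computability.AlgebraicComplexity (complexity nestFreeMatchingPoly)
open Literature.Algebra.Polynomial.NewtonPolytope (newtonPolytope)
open Summit.ValiantsHypothesis.ValiantsHypothesis.Theorems.FifoMatching.QueueGridFace (realOf)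
open Summit.ValiantsHypothesis.ValiantsHypothesis.Theorems.FifoMatching.FewGenerators
  (newtonPolytope_eq_convexHull_range_support)

/-- equal exponents off `Z` ⇒ the exponent points differ by a vector of the coordinate space `span{e_z : z ∈ Z}`. [folklore] -/
theorem realOf_sub_mem_span_single {σ : Type} [Fintype σ] [DecidableEq σ] (Z : Finset σ) (d d' : σ →₀ ℕ)
    (hdd' : ∀ a, a ∉ Z → d a = d' a) :
    realOf d - realOf d' ∈ Submodule.span ℝ (Set.range fun z : ↥Z => (Pi.single (z : σ) (1 : ℝ) : σ → ℝ)) := by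
  have hx : realOf d - realOf d' =
      ∑ a ∈ Z, (realOf d a - realOf d' a) • (Pi.single a (1 : ℝ) : σ → ℝ) := by
    funext b
    simp only [Pi.sub_apply, Finset.sum_apply, Pi.smul_apply, Pi.single_apply, smul_eq_mul, mul_ite,
      mul_one, mul_zero]
    rw [Finset.sum_ite_eq]
    split_ifs with hb
    · rfl
    · simp [realOf, hdd' b hb]
  rw [hx]
  refine Submodule.sum_mem _ fun a ha => Submodule.smul_mem _ _ (Submodule.subset_span ⟨⟨a, ha⟩, rfl⟩)

/-- ★★★ **`NNDivisionHard` ON THE COFACTORS THAT ARE `2^{κ√n}`-SPARSE IN ALL BUT `κ√n` VARIABLES (PROVED, unconditional):**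
`∃ κ > 0, ∀ c`, eventually in `n`, for every `hh ≠ 0` over `ℝ≥0` and every set `Z` of at most `κ·√n` variables such that the
exponents of `hh` take at most `2^{κ·√n}` values OFF `Z` (i.e. `hh = Σ_{i<N} y^{α_i} q_i(z)` with `N ≤ 2^{κ√n}` and arbitrary
`q_i ∈ ℝ≥0[x_z : z ∈ Z]`): `2^((log₂ n + c)^c) < L₊(NN_n · hh) + L₊(hh)` — any degrees, any number of monomials, any Newton
dimension. [cite: HrubesYehudayoff2021, §6 Problem 2] [cite: KaibelWeltge2014, Thm. 1] -/
theorem nnDivisionHard_sparseOffFewVars : ∃ κ : ℝ, 0 < κ ∧ ∀ c : ℕ, ∃ n₀ : ℕ, ∀ n ≥ n₀,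
    ∀ hh : MvPolynomial (Fin (2 * n) × Fin (2 * n)) ℝ≥0, hh ≠ 0 →
      ∀ Z : Finset (Fin (2 * n) × Fin (2 * n)), (Z.card : ℝ) ≤ κ * Real.sqrt n →
        ((hh.support.image fun (d : (Fin (2 * n) × Fin (2 * n)) →₀ ℕ) (a : Fin (2 * n) × Fin (2 * n)) =>
            if a ∈ Z then 0 else d a).card : ℝ) ≤ (2 : ℝ) ^ (κ * Real.sqrt n) →
          2 ^ ((Nat.log 2 n + c) ^ c) < complexity (nestFreeMatchingPoly n ℝ≥0 * hh) + complexity hh := by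
  obtain ⟨κ, hκ, H⟩ := nnDivisionHard_fewFlatsExp
  refine ⟨κ, hκ, fun c => ?_⟩
  obtain ⟨n₀, hn₀⟩ := H c
  refine ⟨n₀, fun n hn hh hh0 Z hZ hcard => ?_⟩
  classical
  haveI : Nonempty hh.support := (MvPolynomial.support_nonempty.2 hh0).coe_sort
  -- labels: the exponent vector off `Z`; direction space: the coordinate space of `Z`
  let rest : ((Fin (2 * n) × Fin (2 * n)) →₀ ℕ) → (Fin (2 * n) × Fin (2 * n)) → ℕ :=
    fun d a => if a ∈ Z then 0 else d a
  let Timg : Finset ((Fin (2 * n) × Fin (2 * n)) → ℕ) := hh.support.image rest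
  let π : hh.support → ↥Timg := fun d => ⟨rest d.1, Finset.mem_image_of_mem rest d.2⟩
  let V : Submodule ℝ ((Fin (2 * n) × Fin (2 * n)) → ℝ) :=
    Submodule.span ℝ (Set.range fun z : ↥Z => (Pi.single (z : Fin (2 * n) × Fin (2 * n)) (1 : ℝ) : _ → ℝ))
  have hV : ∀ j j' : hh.support, π j = π j' →
      realOf (σ := Fin (2 * n) × Fin (2 * n)) j.1 - realOf (σ := Fin (2 * n) × Fin (2 * n)) j'.1 ∈ V := by
    intro j j' hπ
    have hrest : rest j.1 = rest j'.1 := congrArg Subtype.val hπ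
    refine realOf_sub_mem_span_single Z j.1 j'.1 fun a ha => ?_
    have := congrFun hrest a
    simpa [rest, ha] using this
  have hcardT : (Fintype.card ↥Timg : ℝ) ≤ (2 : ℝ) ^ (κ * Real.sqrt n) := by
    rw [Fintype.card_coe]; exact hcard
  have hdimV : (Module.finrank ℝ ↥V : ℝ) ≤ κ * Real.sqrt n := by
    have h1 : Module.finrank ℝ ↥V ≤ Fintype.card ↥Z := finrank_range_le_card _
    rw [Fintype.card_coe] at h1
    exact le_trans (by exact_mod_cast h1) hZ
  exact hn₀ n hn hh hh0 (fun d : hh.support => realOf (σ := Fin (2 * n) × Fin (2 * n)) d.1) π V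
    (newtonPolytope_eq_convexHull_range_support hh) hV hcardT hdimV

end FewFlats

end Summit.ValiantsHypothesis.ValiantsHypothesis.Theorems.FifoMatching

end
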